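import Literature.NumberTheory.Automorphic.UnitaryGroupCongruenceCocompact
import Literature.Geometry.ComplexHyperbolic.UnitBallQuotientManifold
import HarnessLib

/-!
# Congruence subgroups of `U(H)(L⁺)`, `H ∈ M₃(L)`, act properly discontinuously and freely on the ball

Literature layer — REPRODUCTION (kernel proofs; no records, no `Prop` definitions).

Let `L` be a CM number field with complex conjugation `c`, `H ∈ M₃(L)`, `τ : L →+* ℂ` an embedding
and `T ∈ GL₃(ℂ)` a frame with `(T)ᴴ · τ(H) · T = diag(1,1,-1)` (`formCongr (starRingEnd ℂ) T (H.map τ) = J`),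
so that `γ ↦ T⁻¹ γ^τ T` maps `U(H)(L⁺)` into `U(2,1)` (the tree's `archProjU21EmbCM ∘ rationalToArch`).
For a subgroup `Γ ≤ U(H)(L⁺)` this is the homomorphism `archRepU21 … : Γ →* U(2,1)` of this file, with
range the lattice `archImageU21 L H τ T hT Γ ≤ U(2,1)` of
`Literature/NumberTheory/Automorphic/UnitaryGroupCongruenceCocompact.lean`. We PROVE, with NO
uniformisation datum (no surface `X`, no `unif`) among the hypotheses:

* `finite_setOf_norm_entry_archRepU21_le` — **discreteness**: if `H` is positive definite at the
  complex places other than that of `τ` and `Γ` is a congruence subgroup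
  (`IsCongruenceSubgroup c H Γ`), only finitely many `γ ∈ Γ` have all entries of `T⁻¹ γ^τ T` of norm
  `≤ R`; equivalently (`finite_setOf_norm_22_archRepU21_le`) only finitely many have corner entry
  `‖(T⁻¹ γ^τ T)₂₂‖ ≤ R` — the hypothesis shape of the Poincaré-series file
  `ShimuraVarieties/UnitaryBallPoincareSeries.lean`. Proof (Borel 1969, §1: arithmetic groups are
  discrete): the entries of `γ ∈ Γ(𝔫)` are algebraic integers, bounded at `τ` and `τ̄` in terms of
  `T⁻¹ γ^τ T`, and bounded at every other embedding because `U(H^{τ'})` is the unitary group of a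
  DEFINITE form (`Matrix.exists_norm_entry_le_of_posDef`); such algebraic integers form a finite set
  (`NumberField.Embeddings.finite_of_norm_le`), and `Γ(𝔫)` has finite index in `Γ`.
* `finite_setOf_archRepU21_smul_mem` — **proper discontinuity**: for compact `K, L ⊆ 𝔹²` the set
  `{γ | γK ∩ L ≠ ∅}` is finite (`BallModel.exists_norm_entry_le_of_isCompact`).
* `eq_one_of_archRepU21_smul_eq` — **freeness** for torsion-free `Γ`: `γ z = z ⇒ γ = 1`.
* the same three statements for the lattice `Δ = archImageU21 L H τ T hT Γ ≤ U(2,1)` itself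
  (`finite_setOf_norm_entry_le_of_mem_archImageU21`, `finite_setOf_smul_mem_archImageU21`,
  `eq_one_of_smul_eq_of_mem_archImageU21`), hence the instances-as-theorems
  `properlyDiscontinuousSMul_archImageU21 : ProperlyDiscontinuousSMul Δ 𝔹²`,
  `isCancelSMul_archImageU21 : IsCancelSMul Δ 𝔹²` (constructors of
  `Geometry/ComplexHyperbolic/UnitBallQuotientManifold.lean`) and `discreteTopology_archImageU21`;
* **the compact complex surface `S(Γ) = Γ \ 𝔹²` attached to `(L, H, τ, T, Γ)` alone**:
  `isManifold_ballQuotient_archImageU21` (`Δ \ 𝔹²` is a complex manifold modelled on `ℂ²`,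
  `BallModel.instIsManifoldQuotient`), `t2Space_…`, and, for `H` anisotropic,
  `compactSpace_ballQuotient_archImageU21` (cocompactness
  `compactSpace_U21_quotient_archImageU21_of_isCongruenceSubgroup` + `BallModel.compactSpace_quotient_of_compactSpace_quotientGroup`);
* the specialisations `…_of_signature…` literally over the binders of the record
  `PicardCM.BallQuotientUniformised` (`E ⊂ ℂ` a CM field, `conjRingHom E`, frame `Tᴴ H^{τ₁} T = H_{2,1}`).

These are the DATUM-FREE forms of `ShimuraVarieties/UnitaryBallDiscontinuity.lean` (whose statements take a
`D : UnitaryBallUniformisationDatum 2 X`, i.e. presuppose the surface `X = Γ \ 𝔹²` whose construction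
they are the first step of); the proofs are the same, re-based from the datum's fields to binders.

References: A. Borel, *Introduction aux groupes arithmétiques* (Hermann 1969), §1 and Prop. 7.13;
I. R. Shafarevich, *Basic Algebraic Geometry 2*, Ch. IX §3.1 (discrete groups acting freely on the ball);
N. Bergeron, J. Millson, C. Moeglin, Acta Math. 216 (2016), Introduction §1.1 (`S(Γ) = Γ\X`).

## Provenance

Written for the pub-hodgecm2 cell (COR-CM), LIT-FANOUT row D4 residual R0 of `HOME/lit/audit-D4.md`
(«re-base K1 X-free»): the input of the construction of the ball quotient `S(Γ)` as a compact complex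
surface from `(E, H, Γ)` alone. Nothing here is a claim of the manuscripts adjudicated by that cell.
-/

set_option autoImplicit false

noncomputable section

open Matrix Complex ComplexConjugate NumberField InfinitePlace
open scoped MatrixGroups ComplexOrder Manifold ContDiff

namespace Literature.NumberTheory.Automorphic

namespace UnitaryGroup

open Literature.AlgebraicGeometry.ShimuraVarieties
open Literature.Geometry.ComplexHyperbolic Literature.Geometry.ComplexHyperbolic.BallModel

section CM

variable (L : Type) [Field L] [NumberField L] [IsCMField L] (H : Matrix (Fin 3) (Fin 3) L)
  (τ : L →+* ℂ) (T : GL (Fin 3) ℂ) (hT : formCongr (starRingEnd ℂ) T (H.map τ) = BallModel.J)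

/-! ### The homomorphism `Γ → U(2,1)`, `γ ↦ T⁻¹ γ^τ T` -/

/-- **`ρ_T : Γ →* U(2,1)`, `γ ↦ T⁻¹ γ^τ T`**, for a subgroup `Γ ≤ U(H)(L⁺)` (`rational L⁺ L c 3 H`):
the restriction to `Γ` of `archProjU21EmbCM ∘ rationalToArch` (Borel–Jacquet 1979, §4.1: the
archimedean component of `γ ⊗ 1`). [cite: BorelJacquet1979, §4.1] -/
def archRepU21 {Γ : Subgroup (GL (Fin 3) L)}
    (hΓ : Γ ≤ rational (↥(maximalRealSubfield L)) L (IsCMField.complexConj L) 3 H) : Γ →* U21 :=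
  (archProjU21EmbCM L H τ T hT).comp
    ((rationalToArch (↥(maximalRealSubfield L)) L (IsCMField.complexConj L) 3 H).comp
      (Subgroup.inclusion hΓ))

variable {Γ : Subgroup (GL (Fin 3) L)}
  (hΓ : Γ ≤ rational (↥(maximalRealSubfield L)) L (IsCMField.complexConj L) 3 H)

/-- `archRepU21 γ = archProjU21EmbCM (γ ⊗ 1)` (the archimedean component of `γ ⊗ 1`).
[cite: BorelJacquet1979, §4.1] -/
theorem archRepU21_apply (γ : Γ) :
    archRepU21 L H τ T hT hΓ γ =
      archProjU21EmbCM L H τ T hT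
        (rationalToArch (↥(maximalRealSubfield L)) L (IsCMField.complexConj L) 3 H
          (Subgroup.inclusion hΓ γ)) :=
  rfl

/-- **The matrix of `ρ_T(γ)` is `T⁻¹ γ^τ T`.** [cite: BorelJacquet1979, §4.1] -/
theorem mat_archRepU21 (γ : Γ) :
    mat (archRepU21 L H τ T hT hΓ γ) =
      ((T⁻¹ : GL (Fin 3) ℂ) : Matrix (Fin 3) (Fin 3) ℂ) *
        ((γ : GL (Fin 3) L) : Matrix (Fin 3) (Fin 3) L).map τ * (T : Matrix (Fin 3) (Fin 3) ℂ) := by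
  have hm : ((Matrix.GeneralLinearGroup.map τ (γ : GL (Fin 3) L) : GL (Fin 3) ℂ) :
        Matrix (Fin 3) (Fin 3) ℂ) = ((γ : GL (Fin 3) L) : Matrix (Fin 3) (Fin 3) L).map τ :=
    Matrix.ext fun i j ↦ Matrix.GeneralLinearGroup.map_apply _ _ _ _
  rw [← hm]
  simp only [mat, archRepU21_apply, coe_archProjU21EmbCM_rationalToArch, Units.val_mul,
    Subgroup.coe_inclusion]

/-- `γ^τ = T · ρ_T(γ) · T⁻¹`. [cite: BorelJacquet1979, §4.1] -/
theorem map_eq_mul_mat_archRepU21_mul (γ : Γ) :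
    ((γ : GL (Fin 3) L) : Matrix (Fin 3) (Fin 3) L).map τ =
      (T : Matrix (Fin 3) (Fin 3) ℂ) * mat (archRepU21 L H τ T hT hΓ γ) *
        ((T⁻¹ : GL (Fin 3) ℂ) : Matrix (Fin 3) (Fin 3) ℂ) := by
  have h1 : (T : Matrix (Fin 3) (Fin 3) ℂ) * ((T⁻¹ : GL (Fin 3) ℂ) : Matrix (Fin 3) (Fin 3) ℂ) = 1 := by
    rw [← Units.val_mul, mul_inv_cancel, Units.val_one]
  rw [mat_archRepU21]
  calc ((γ : GL (Fin 3) L) : Matrix (Fin 3) (Fin 3) L).map τ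
      = ((T : Matrix (Fin 3) (Fin 3) ℂ) * ((T⁻¹ : GL (Fin 3) ℂ) : Matrix (Fin 3) (Fin 3) ℂ)) *
          ((γ : GL (Fin 3) L) : Matrix (Fin 3) (Fin 3) L).map τ *
          ((T : Matrix (Fin 3) (Fin 3) ℂ) * ((T⁻¹ : GL (Fin 3) ℂ) : Matrix (Fin 3) (Fin 3) ℂ)) := by
        rw [h1, Matrix.one_mul, Matrix.mul_one]
    _ = (T : Matrix (Fin 3) (Fin 3) ℂ) * (((T⁻¹ : GL (Fin 3) ℂ) : Matrix (Fin 3) (Fin 3) ℂ) *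
          ((γ : GL (Fin 3) L) : Matrix (Fin 3) (Fin 3) L).map τ * (T : Matrix (Fin 3) (Fin 3) ℂ)) *
          ((T⁻¹ : GL (Fin 3) ℂ) : Matrix (Fin 3) (Fin 3) ℂ) := by
        simp only [Matrix.mul_assoc]

/-- **`ρ_T` is injective** (`τ` is injective and `T` is invertible): `G(ℚ) ↪ G(ℝ)`.
[cite: BorelJacquet1979, §4.1] -/
theorem archRepU21_injective : Function.Injective (archRepU21 L H τ T hT hΓ) := by
  intro γ γ' h
  have hmap : ((γ : GL (Fin 3) L) : Matrix (Fin 3) (Fin 3) L).map τ =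
      ((γ' : GL (Fin 3) L) : Matrix (Fin 3) (Fin 3) L).map τ := by
    rw [map_eq_mul_mat_archRepU21_mul L H τ T hT hΓ γ, map_eq_mul_mat_archRepU21_mul L H τ T hT hΓ γ', h]
  have hmat : ((γ : GL (Fin 3) L) : Matrix (Fin 3) (Fin 3) L) =
      ((γ' : GL (Fin 3) L) : Matrix (Fin 3) (Fin 3) L) := by
    ext i j
    exact τ.injective (by simpa only [Matrix.map_apply] using congr_fun (congr_fun hmap i) j)
  exact Subtype.ext (Units.ext hmat)

/-- **The range of `ρ_T` is the lattice `archImageU21 L H τ T hT Γ ≤ U(2,1)`** of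
`UnitaryGroupCongruenceCocompact.lean` (the image of the arithmetic subgroup in `G(ℝ)`).
[cite: BorelJacquet1979, §4.1] -/
theorem range_archRepU21 : (archRepU21 L H τ T hT hΓ).range = archImageU21 L H τ T hT Γ := by
  ext b
  rw [MonoidHom.mem_range, mem_archImageU21_iff]
  constructor
  · rintro ⟨γ, rfl⟩
    exact ⟨Subgroup.inclusion hΓ γ, γ.2, rfl⟩
  · rintro ⟨γ, hγ, rfl⟩
    exact ⟨⟨γ, hγ⟩, rfl⟩

/-- Every element of `archImageU21 … Γ` is `ρ_T(γ)` for some `γ ∈ Γ`. [cite: BorelJacquet1979, §4.1] -/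
theorem exists_archRepU21_eq_of_mem_archImageU21 {b : U21} (hb : b ∈ archImageU21 L H τ T hT Γ) :
    ∃ γ : Γ, archRepU21 L H τ T hT hΓ γ = b := by
  rw [← range_archRepU21 L H τ T hT hΓ] at hb
  exact MonoidHom.mem_range.1 hb

/-- `ρ_T(γ) ∈ archImageU21 … Γ`. [cite: BorelJacquet1979, §4.1] -/
theorem archRepU21_mem_archImageU21 (γ : Γ) :
    archRepU21 L H τ T hT hΓ γ ∈ archImageU21 L H τ T hT Γ := by
  rw [← range_archRepU21 L H τ T hT hΓ]
  exact ⟨γ, rfl⟩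

/-! ### Entries of `Γ` at the complex embeddings of `L` -/

/-- An isometry of `(V, H)` is unitary for `H^{τ'}` at EVERY complex embedding `τ'`:
`(γ^{τ'})ᴴ H^{τ'} γ^{τ'} = H^{τ'}` (apply `τ'` to `(cγ)ᵀ H γ = H`; `τ' ∘ c = conj ∘ τ'`).
[cite: BergeronMillsonMoeglin2016Balls, Part 2 §1.2] -/
theorem conjTranspose_map_mul_map_of_mem_rational (τ' : L →+* ℂ) {γ : GL (Fin 3) L}
    (hγ : γ ∈ rational (↥(maximalRealSubfield L)) L (IsCMField.complexConj L) 3 H) :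
    (((γ : Matrix (Fin 3) (Fin 3) L).map τ')ᴴ * H.map τ' * (γ : Matrix (Fin 3) (Fin 3) L).map τ') =
      H.map τ' := by
  have h := congrArg (fun M : Matrix (Fin 3) (Fin 3) L ↦ M.map τ') (mem_unitaryGroupOfForm_iff.1 hγ)
  simp only [Matrix.map_mul] at h
  have ht : (((γ : Matrix (Fin 3) (Fin 3) L).map
        ((IsCMField.complexConj L : L ≃ₐ[↥(maximalRealSubfield L)] L) : L →+* L))ᵀ).map τ' =
      ((γ : Matrix (Fin 3) (Fin 3) L).map τ')ᴴ := by
    ext i j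
    simp only [Matrix.map_apply, transpose_apply, conjTranspose_apply, Complex.star_def,
      RingHom.coe_coe, IsCMField.complexEmbedding_complexConj]
  rwa [ht] at h

include hΓ in
/-- **Bounded at the definite places**: at a complex embedding `τ'` where `H^{τ'}` is positive
definite, the entries `τ'(γᵢⱼ)`, `γ ∈ Γ ≤ U(H)(L⁺)`, are bounded by a constant (`U(H^{τ'})` is
compact). [cite: PlatonovRapinchuk1994, §3.2 Thm 3.1] -/
theorem exists_norm_embedding_apply_le_of_posDef (τ' : L →+* ℂ) (hdef : (H.map τ').PosDef) :
    ∃ C : ℝ, ∀ γ : Γ, ∀ i j,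
      ‖τ' (((γ : GL (Fin 3) L) : Matrix (Fin 3) (Fin 3) L) i j)‖ ≤ C := by
  obtain ⟨C, hC⟩ := Literature.NumberTheory.Automorphic.Matrix.exists_norm_entry_le_of_posDef hdef
  refine ⟨C, fun γ i j ↦ ?_⟩
  have h := hC _ (conjTranspose_map_mul_map_of_mem_rational L H τ' (hΓ γ.2)) i j
  rwa [Matrix.map_apply] at h

omit [NumberField L] [IsCMField L] in
/-- **Integrality on `Γ(𝔫)`**: the entries of an element of the principal congruence subgroup are
algebraic integers (`γ = 1 + 𝔫 A`, `A ∈ M(𝓞_L)`; arithmetic subgroups are commensurable with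
`G ∩ GL_n(𝓞)`). [cite: Borel1969, §1] -/
theorem isIntegral_apply_of_mem_principalCongruenceSubgroup {σ : L →+* L} {n : ℕ}
    {γ : GL (Fin 3) L} (hγ : γ ∈ principalCongruenceSubgroup σ H n) (i j : Fin 3) :
    IsIntegral ℤ ((γ : Matrix (Fin 3) (Fin 3) L) i j) := by
  obtain ⟨A, hA⟩ := hγ.2.1
  have hmap : (γ : Matrix (Fin 3) (Fin 3) L) = (1 + n • A).map (algebraMap (𝓞 L) L) := by
    rw [hA]
    change _ = (algebraMap (𝓞 L) L).mapMatrix (1 + n • A)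
    rw [map_add, map_one, map_nsmul]
    rfl
  rw [hmap, Matrix.map_apply]
  exact RingOfIntegers.isIntegral_coe _

omit [NumberField L] [IsCMField L] in
/-- At the conjugate embedding the entries have the same norms as at `τ`. [folklore] -/
private theorem norm_embedding_eq_of_mk_eq {τ' : L →+* ℂ} (hτ' : InfinitePlace.mk τ' = InfinitePlace.mk τ)
    (x : L) : ‖τ' x‖ = ‖τ x‖ := by
  rcases InfinitePlace.mk_eq_iff.1 hτ' with h | h
  · rw [h]
  · rw [← h, ComplexEmbedding.conjugate_coe_eq, Complex.norm_conj]

/-! ### Discreteness of `ρ_T(Γ)` in `U(2,1)` -/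

/-- Every entry of a `3 × 3` complex matrix is bounded by the sum of the norms of all entries.
[folklore] -/
private theorem norm_apply_le_sum_norm (M : Matrix (Fin 3) (Fin 3) ℂ) (i j : Fin 3) :
    ‖M i j‖ ≤ ∑ i', ∑ j', ‖M i' j'‖ := by
  calc ‖M i j‖ ≤ ∑ j', ‖M i j'‖ :=
        Finset.single_le_sum (f := fun j' ↦ ‖M i j'‖) (fun _ _ ↦ norm_nonneg _) (Finset.mem_univ j)
    _ ≤ ∑ i', ∑ j', ‖M i' j'‖ :=
        Finset.single_le_sum (f := fun i' ↦ ∑ j', ‖M i' j'‖)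
          (fun _ _ ↦ Finset.sum_nonneg fun _ _ ↦ norm_nonneg _) (Finset.mem_univ i)

/-- **Bounded at `τ` in terms of `ρ_T`**: if the entries of `ρ_T(γ)` have norm `≤ R` then
`‖τ(γᵢⱼ)‖ ≤ 9 · B(T) · R · B(T⁻¹)` with `B(M) = Σ ‖Mᵢⱼ‖` (the place of `τ` contributes a bounded set
once the image in `G(ℝ) = U(2,1)` is bounded). [cite: Borel1969, §1] -/
theorem norm_embedding_apply_le_of_norm_mat_archRepU21_le {γ : Γ} {R : ℝ}
    (h : ∀ i j, ‖mat (archRepU21 L H τ T hT hΓ γ) i j‖ ≤ R) (i j : Fin 3) :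
    ‖τ (((γ : GL (Fin 3) L) : Matrix (Fin 3) (Fin 3) L) i j)‖ ≤
      3 * (3 * ((∑ i', ∑ j', ‖(T : Matrix (Fin 3) (Fin 3) ℂ) i' j'‖) * R) *
        ∑ i', ∑ j', ‖((T⁻¹ : GL (Fin 3) ℂ) : Matrix (Fin 3) (Fin 3) ℂ) i' j'‖) := by
  have h1 : ‖τ (((γ : GL (Fin 3) L) : Matrix (Fin 3) (Fin 3) L) i j)‖ =
      ‖((T : Matrix (Fin 3) (Fin 3) ℂ) * mat (archRepU21 L H τ T hT hΓ γ) *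
          ((T⁻¹ : GL (Fin 3) ℂ) : Matrix (Fin 3) (Fin 3) ℂ)) i j‖ := by
    rw [← map_eq_mul_mat_archRepU21_mul L H τ T hT hΓ γ, Matrix.map_apply]
  rw [h1]
  exact norm_mul_apply_le (norm_mul_apply_le (norm_apply_le_sum_norm _) h)
    (norm_apply_le_sum_norm _) i j

/-- **Bounded at all embeddings**: if `H` is positive definite at the complex places other than that of
`τ`, then for each `R` there is `B` such that every `γ ∈ Γ` whose image `ρ_T(γ)` has entries of norm
`≤ R` has `‖τ'(γᵢⱼ)‖ ≤ B` for EVERY complex embedding `τ'` of `L`. [cite: PlatonovRapinchuk1994, §3.2 Thm 3.1] -/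
theorem exists_forall_norm_embedding_apply_le
    (hdef : ∀ τ' : L →+* ℂ, InfinitePlace.mk τ' ≠ InfinitePlace.mk τ → (H.map τ').PosDef) (R : ℝ) :
    ∃ B : ℝ, ∀ γ : Γ, (∀ i j, ‖mat (archRepU21 L H τ T hT hΓ γ) i j‖ ≤ R) →
      ∀ (τ' : L →+* ℂ) (i j : Fin 3),
        ‖τ' (((γ : GL (Fin 3) L) : Matrix (Fin 3) (Fin 3) L) i j)‖ ≤ B := by
  have hC : ∀ τ' : L →+* ℂ, ∃ C : ℝ, InfinitePlace.mk τ' ≠ InfinitePlace.mk τ →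
      ∀ γ : Γ, ∀ i j, ‖τ' (((γ : GL (Fin 3) L) : Matrix (Fin 3) (Fin 3) L) i j)‖ ≤ C := by
    intro τ'
    by_cases hτ' : InfinitePlace.mk τ' = InfinitePlace.mk τ
    · exact ⟨0, fun h ↦ (h hτ').elim⟩
    · obtain ⟨C, hC⟩ := exists_norm_embedding_apply_le_of_posDef L H hΓ τ' (hdef τ' hτ')
      exact ⟨C, fun _ ↦ hC⟩
  choose C hC using hC
  set BT : ℝ := ∑ i', ∑ j', ‖(T : Matrix (Fin 3) (Fin 3) ℂ) i' j'‖
  set BTi : ℝ := ∑ i', ∑ j', ‖((T⁻¹ : GL (Fin 3) ℂ) : Matrix (Fin 3) (Fin 3) ℂ) i' j'‖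
  refine ⟨3 * (3 * (BT * |R|) * BTi) + ∑ τ', |C τ'|, fun γ hγ τ' i j ↦ ?_⟩
  have hR : ∀ i j, ‖mat (archRepU21 L H τ T hT hΓ γ) i j‖ ≤ |R| :=
    fun i j ↦ (hγ i j).trans (le_abs_self R)
  have h0 : 0 ≤ 3 * (3 * (BT * |R|) * BTi) :=
    (norm_nonneg _).trans (norm_embedding_apply_le_of_norm_mat_archRepU21_le L H τ T hT hΓ hR 0 0)
  have hsum : 0 ≤ ∑ τ'', |C τ''| := Finset.sum_nonneg fun _ _ ↦ abs_nonneg _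
  by_cases hτ' : InfinitePlace.mk τ' = InfinitePlace.mk τ
  · rw [norm_embedding_eq_of_mk_eq L τ hτ']
    exact (norm_embedding_apply_le_of_norm_mat_archRepU21_le L H τ T hT hΓ hR i j).trans
      (le_add_of_nonneg_right hsum)
  · calc ‖τ' (((γ : GL (Fin 3) L) : Matrix (Fin 3) (Fin 3) L) i j)‖ ≤ C τ' := hC τ' hτ' γ i j
      _ ≤ |C τ'| := le_abs_self _
      _ ≤ ∑ τ'', |C τ''| :=
          Finset.single_le_sum (f := fun τ'' ↦ |C τ''|) (fun _ _ ↦ abs_nonneg _) (Finset.mem_univ τ')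
      _ ≤ _ := le_add_of_nonneg_left h0

/-- **Finiteness inside `Γ(𝔫)`**: only finitely many `γ ∈ Γ ∩ Γ(𝔫)` have `ρ_T(γ)` with entries of
norm `≤ R` (integral elements of `L` with all conjugates bounded form a finite set).
[cite: Borel1969, §1] -/
theorem finite_setOf_mem_principalCongruenceSubgroup_norm_entry_le
    (hdef : ∀ τ' : L →+* ℂ, InfinitePlace.mk τ' ≠ InfinitePlace.mk τ → (H.map τ').PosDef)
    (σ : L →+* L) (n : ℕ) (R : ℝ) :
    {γ : Γ | (γ : GL (Fin 3) L) ∈ principalCongruenceSubgroup σ H n ∧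
      ∀ i j, ‖mat (archRepU21 L H τ T hT hΓ γ) i j‖ ≤ R}.Finite := by
  obtain ⟨B, hB⟩ := exists_forall_norm_embedding_apply_le L H τ T hT hΓ hdef R
  set S : Set L := {x : L | IsIntegral ℤ x ∧ ∀ φ : L →+* ℂ, ‖φ x‖ ≤ B} with hS
  have hSfin : S.Finite := Embeddings.finite_of_norm_le L ℂ B
  haveI : Finite S := hSfin.to_subtype
  -- every such `γ` has its matrix in the (finite) range of `(Fin 3 → Fin 3 → S) → M₃(L)`
  let F : (Fin 3 → Fin 3 → S) → Matrix (Fin 3) (Fin 3) L := fun f ↦ Matrix.of fun i j ↦ (f i j : L)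
  have hrange : (Set.range F).Finite := Set.finite_range F
  let M : Γ → Matrix (Fin 3) (Fin 3) L := fun γ ↦ ((γ : GL (Fin 3) L) : Matrix (Fin 3) (Fin 3) L)
  have hMinj : Function.Injective M := fun γ γ' h ↦ Subtype.ext (Units.ext h)
  refine (hrange.preimage hMinj.injOn).subset fun γ hγ ↦ ?_
  refine ⟨fun i j ↦ ⟨M γ i j, isIntegral_apply_of_mem_principalCongruenceSubgroup L H hγ.1 i j,
    fun φ ↦ hB γ hγ.2 φ i j⟩, ?_⟩
  ext i j
  rfl

variable {hΓ}

/-- **Discreteness**: for a congruence subgroup `Γ` of `U(H)(L⁺)` with `H` definite off the place of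
`τ`, only finitely many `γ ∈ Γ` have `ρ_T(γ) ∈ U(2,1)` with all entries of norm `≤ R`. (Reduce to
`Γ(𝔫)`, of finite index in `Γ`: write `γ = s·δ` with `s` a coset representative and `δ ∈ Γ(𝔫)`, whose
entries are then bounded too.) [cite: Borel1969, §1] -/
theorem finite_setOf_norm_entry_archRepU21_le
    (hdef : ∀ τ' : L →+* ℂ, InfinitePlace.mk τ' ≠ InfinitePlace.mk τ → (H.map τ').PosDef)
    (hΓc : IsCongruenceSubgroup
      ((IsCMField.complexConj L : L ≃ₐ[↥(maximalRealSubfield L)] L) : L →+* L) H Γ) (R : ℝ) :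
    {γ : Γ | ∀ i j, ‖mat (archRepU21 L H τ T hT hΓc.le_rational γ) i j‖ ≤ R}.Finite := by
  obtain ⟨n, -, -, hfi⟩ := hΓc.2
  set ρ := archRepU21 L H τ T hT hΓc.le_rational
  set N : Subgroup Γ := (principalCongruenceSubgroup
    ((IsCMField.complexConj L : L ≃ₐ[↥(maximalRealSubfield L)] L) : L →+* L) H n).subgroupOf Γ
  haveI : N.FiniteIndex := hfi
  -- coset representatives and a common bound for their inverses
  let s : Γ ⧸ N → Γ := fun q ↦ q.out
  haveI : Fintype (Γ ⧸ N) := Fintype.ofFinite _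
  let C : ℝ := ∑ q : Γ ⧸ N, ‖mat (ρ (s q)) 2 2‖
  have hCq : ∀ q i j, ‖mat (ρ (s q))⁻¹ i j‖ ≤ C := fun q i j ↦ by
    calc ‖mat (ρ (s q))⁻¹ i j‖ = ‖mat (ρ (s q)) j i‖ := norm_mat_inv_apply _ i j
      _ ≤ ‖mat (ρ (s q)) 2 2‖ := norm_entry_le_norm_22 _ j i
      _ ≤ C := Finset.single_le_sum (f := fun q' ↦ ‖mat (ρ (s q')) 2 2‖)
          (fun _ _ ↦ norm_nonneg _) (Finset.mem_univ q)
  -- the finite set of pairs (coset, bounded element of `Γ(𝔫)`)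
  have hfin := (Set.finite_univ (α := Γ ⧸ N)).prod
    (finite_setOf_mem_principalCongruenceSubgroup_norm_entry_le L H τ T hT hΓc.le_rational hdef
      ((IsCMField.complexConj L : L ≃ₐ[↥(maximalRealSubfield L)] L) : L →+* L) n (3 * (C * R)))
  refine (hfin.image fun qδ ↦ s qδ.1 * qδ.2).subset fun γ hγ ↦ ?_
  refine ⟨((γ : Γ ⧸ N), (s (γ : Γ ⧸ N))⁻¹ * γ), ⟨Set.mem_univ _, ?_, ?_⟩, by simp⟩
  · have hmem : (s (γ : Γ ⧸ N))⁻¹ * γ ∈ N := by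
      rw [← QuotientGroup.eq]
      exact QuotientGroup.out_eq' _
    exact Subgroup.mem_subgroupOf.1 hmem
  · intro i j
    rw [map_mul, map_inv, mat_mul]
    exact norm_mul_apply_le (hCq _) hγ i j

/-- **Discreteness, corner-entry form**: only finitely many `γ ∈ Γ` have `‖ρ_T(γ)₂₂‖ ≤ R` (every entry
of an element of `U(2,1)` is dominated by the corner entry, `BallModel.norm_entry_le_norm_22`). This is
the hypothesis `∀ R, {γ | ‖mat (ρ γ) 2 2‖ ≤ R}.Finite` of the Poincaré series file
`ShimuraVarieties/UnitaryBallPoincareSeries.lean`, discharged for arithmetic `Γ`. [cite: Borel1969, §1] -/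
theorem finite_setOf_norm_22_archRepU21_le
    (hdef : ∀ τ' : L →+* ℂ, InfinitePlace.mk τ' ≠ InfinitePlace.mk τ → (H.map τ').PosDef)
    (hΓc : IsCongruenceSubgroup
      ((IsCMField.complexConj L : L ≃ₐ[↥(maximalRealSubfield L)] L) : L →+* L) H Γ) (R : ℝ) :
    {γ : Γ | ‖mat (archRepU21 L H τ T hT hΓc.le_rational γ) 2 2‖ ≤ R}.Finite :=
  (finite_setOf_norm_entry_archRepU21_le L H τ T hT hdef hΓc R).subset fun _ hγ i j ↦
    (norm_entry_le_norm_22 _ i j).trans hγ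

/-! ### Proper discontinuity and freeness -/

/-- **Proper discontinuity**: for compact `K, K' ⊆ 𝔹²`, only finitely many `γ ∈ Γ` move a point of `K`
into `K'`. [cite: Borel1969, Prop. 7.13] -/
theorem finite_setOf_archRepU21_smul_mem
    (hdef : ∀ τ' : L →+* ℂ, InfinitePlace.mk τ' ≠ InfinitePlace.mk τ → (H.map τ').PosDef)
    (hΓc : IsCongruenceSubgroup
      ((IsCMField.complexConj L : L ≃ₐ[↥(maximalRealSubfield L)] L) : L →+* L) H Γ)
    {K K' : Set Ball} (hK : IsCompact K) (hK' : IsCompact K') :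
    {γ : Γ | ∃ z ∈ K, archRepU21 L H τ T hT hΓc.le_rational γ • z ∈ K'}.Finite := by
  obtain ⟨R, hR⟩ := exists_norm_entry_le_of_isCompact hK hK'
  exact (finite_setOf_norm_entry_archRepU21_le L H τ T hT hdef hΓc R).subset
    fun _ ⟨z, hz, hγz⟩ ↦ hR _ z hz hγz

/-- Stabilisers are finite. [cite: Borel1969, Prop. 7.13] -/
theorem finite_setOf_archRepU21_smul_eq
    (hdef : ∀ τ' : L →+* ℂ, InfinitePlace.mk τ' ≠ InfinitePlace.mk τ → (H.map τ').PosDef)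
    (hΓc : IsCongruenceSubgroup
      ((IsCMField.complexConj L : L ≃ₐ[↥(maximalRealSubfield L)] L) : L →+* L) H Γ) (z : Ball) :
    {γ : Γ | archRepU21 L H τ T hT hΓc.le_rational γ • z = z}.Finite :=
  (finite_setOf_archRepU21_smul_mem L H τ T hT hdef hΓc (isCompact_singleton (x := z))
    isCompact_singleton).subset fun γ hγ ↦
      ⟨z, rfl, by simpa only [Set.mem_singleton_iff, Set.mem_setOf_eq] using hγ⟩

/-- **Freeness**: a torsion-free congruence subgroup `Γ` acts freely on the ball — `γ z = z ⇒ γ = 1`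
(the stabiliser of `z` is finite, so `γ` has finite order). [cite: BergeronMillsonMoeglin2016Balls, Introduction §1.1] -/
theorem eq_one_of_archRepU21_smul_eq
    (hdef : ∀ τ' : L →+* ℂ, InfinitePlace.mk τ' ≠ InfinitePlace.mk τ → (H.map τ').PosDef)
    (hΓc : IsCongruenceSubgroup
      ((IsCMField.complexConj L : L ≃ₐ[↥(maximalRealSubfield L)] L) : L →+* L) H Γ)
    (htf : ∀ γ ∈ Γ, IsOfFinOrder γ → γ = 1) {γ : Γ} {z : Ball}
    (h : archRepU21 L H τ T hT hΓc.le_rational γ • z = z) : γ = 1 := by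
  have hΓ' : IsOfFinOrder γ := by
    by_contra hnot
    have hinj : Function.Injective fun k : ℕ ↦ γ ^ k := injective_pow_iff_not_isOfFinOrder.2 hnot
    refine (Set.infinite_range_of_injective hinj).mono ?_
      (finite_setOf_archRepU21_smul_eq L H τ T hT hdef hΓc z)
    rintro _ ⟨k, rfl⟩
    show archRepU21 L H τ T hT hΓc.le_rational (γ ^ k) • z = z
    rw [map_pow]
    exact (MulAction.stabilizer U21 z).pow_mem h k
  have hGL : IsOfFinOrder (γ : GL (Fin 3) L) := Γ.subtype.isOfFinOrder hΓ'
  exact OneMemClass.coe_eq_one.1 (htf _ γ.2 hGL)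

/-- The orbit map `γ ↦ ρ_T(γ) z` of a torsion-free congruence subgroup is injective (free action).
[cite: BergeronMillsonMoeglin2016Balls, Introduction §1.1] -/
theorem archRepU21_smul_left_injective
    (hdef : ∀ τ' : L →+* ℂ, InfinitePlace.mk τ' ≠ InfinitePlace.mk τ → (H.map τ').PosDef)
    (hΓc : IsCongruenceSubgroup
      ((IsCMField.complexConj L : L ≃ₐ[↥(maximalRealSubfield L)] L) : L →+* L) H Γ)
    (htf : ∀ γ ∈ Γ, IsOfFinOrder γ → γ = 1) (z : Ball) :
    Function.Injective fun γ : Γ ↦ archRepU21 L H τ T hT hΓc.le_rational γ • z := by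
  intro γ γ' h
  have h' : archRepU21 L H τ T hT hΓc.le_rational (γ'⁻¹ * γ) • z = z := by
    simp only at h
    rw [map_mul, map_inv, mul_smul, h, inv_smul_smul]
  have := eq_one_of_archRepU21_smul_eq L H τ T hT hdef hΓc htf h'
  rw [inv_mul_eq_one] at this
  exact this.symm

/-! ### The lattice `Δ = archImageU21 L H τ T hT Γ ≤ U(2,1)` acting on the ball -/

/-- **Discreteness of `Δ`**: only finitely many `δ ∈ Δ = {T⁻¹ γ^τ T | γ ∈ Γ}` have all entries of norm
`≤ R`. [cite: Borel1969, §1] -/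
theorem finite_setOf_norm_entry_le_of_mem_archImageU21
    (hdef : ∀ τ' : L →+* ℂ, InfinitePlace.mk τ' ≠ InfinitePlace.mk τ → (H.map τ').PosDef)
    (hΓc : IsCongruenceSubgroup
      ((IsCMField.complexConj L : L ≃ₐ[↥(maximalRealSubfield L)] L) : L →+* L) H Γ) (R : ℝ) :
    {δ : archImageU21 L H τ T hT Γ | ∀ i j, ‖mat (δ : U21) i j‖ ≤ R}.Finite := by
  set ρ := archRepU21 L H τ T hT hΓc.le_rational
  let f : Γ → archImageU21 L H τ T hT Γ :=
    fun γ ↦ ⟨ρ γ, archRepU21_mem_archImageU21 L H τ T hT hΓc.le_rational γ⟩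
  refine ((finite_setOf_norm_entry_archRepU21_le L H τ T hT hdef hΓc R).image f).subset
    fun δ hδ ↦ ?_
  obtain ⟨γ, hγ⟩ := exists_archRepU21_eq_of_mem_archImageU21 L H τ T hT hΓc.le_rational δ.2
  refine ⟨γ, fun i j ↦ ?_, Subtype.ext hγ⟩
  have := hδ i j
  rwa [← hγ] at this

/-- **Discreteness of `Δ`, corner-entry form**: `{δ ∈ Δ | ‖δ₂₂‖ ≤ R}` is finite — the hypothesis of
`ShimuraVarieties/UnitaryBallPoincareSeries.lean` for `ρ = Δ.subtype`. [cite: Borel1969, §1] -/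
theorem finite_setOf_norm_22_le_of_mem_archImageU21
    (hdef : ∀ τ' : L →+* ℂ, InfinitePlace.mk τ' ≠ InfinitePlace.mk τ → (H.map τ').PosDef)
    (hΓc : IsCongruenceSubgroup
      ((IsCMField.complexConj L : L ≃ₐ[↥(maximalRealSubfield L)] L) : L →+* L) H Γ) (R : ℝ) :
    {δ : archImageU21 L H τ T hT Γ | ‖mat (δ : U21) 2 2‖ ≤ R}.Finite :=
  (finite_setOf_norm_entry_le_of_mem_archImageU21 L H τ T hT hdef hΓc R).subset fun _ hδ i j ↦
    (norm_entry_le_norm_22 _ i j).trans hδ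

/-- **Proper discontinuity of `Δ` on `𝔹²`**: for compact `K, K' ⊆ 𝔹²` only finitely many `δ ∈ Δ` move
a point of `K` into `K'`. [cite: Borel1969, Prop. 7.13] -/
theorem finite_setOf_smul_mem_archImageU21
    (hdef : ∀ τ' : L →+* ℂ, InfinitePlace.mk τ' ≠ InfinitePlace.mk τ → (H.map τ').PosDef)
    (hΓc : IsCongruenceSubgroup
      ((IsCMField.complexConj L : L ≃ₐ[↥(maximalRealSubfield L)] L) : L →+* L) H Γ)
    {K K' : Set Ball} (hK : IsCompact K) (hK' : IsCompact K') :
    {δ : archImageU21 L H τ T hT Γ | ∃ z ∈ K, δ • z ∈ K'}.Finite := by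
  obtain ⟨R, hR⟩ := exists_norm_entry_le_of_isCompact hK hK'
  exact (finite_setOf_norm_entry_le_of_mem_archImageU21 L H τ T hT hdef hΓc R).subset
    fun _ ⟨z, hz, hδz⟩ ↦ hR _ z hz hδz

/-- **Freeness of `Δ` on `𝔹²`** for torsion-free `Γ`: `δ z = z ⇒ δ = 1`.
[cite: BergeronMillsonMoeglin2016Balls, Introduction §1.1] -/
theorem eq_one_of_smul_eq_of_mem_archImageU21
    (hdef : ∀ τ' : L →+* ℂ, InfinitePlace.mk τ' ≠ InfinitePlace.mk τ → (H.map τ').PosDef)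
    (hΓc : IsCongruenceSubgroup
      ((IsCMField.complexConj L : L ≃ₐ[↥(maximalRealSubfield L)] L) : L →+* L) H Γ)
    (htf : ∀ γ ∈ Γ, IsOfFinOrder γ → γ = 1) (δ : archImageU21 L H τ T hT Γ) (z : Ball)
    (h : δ • z = z) : δ = 1 := by
  obtain ⟨γ, hγ⟩ := exists_archRepU21_eq_of_mem_archImageU21 L H τ T hT hΓc.le_rational δ.2
  have h' : archRepU21 L H τ T hT hΓc.le_rational γ • z = z := by rw [hγ]; exact h
  have h1 := eq_one_of_archRepU21_smul_eq L H τ T hT hdef hΓc htf h'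
  rw [h1, map_one] at hγ
  exact Subtype.ext hγ.symm

/-- **`Δ` acts properly discontinuously on `𝔹²`** (Mathlib's `ProperlyDiscontinuousSMul`, through the
constructor `BallModel.properlyDiscontinuousSMul_of_finite`). [cite: Borel1969, Prop. 7.13] -/
theorem properlyDiscontinuousSMul_archImageU21
    (hdef : ∀ τ' : L →+* ℂ, InfinitePlace.mk τ' ≠ InfinitePlace.mk τ → (H.map τ').PosDef)
    (hΓc : IsCongruenceSubgroup
      ((IsCMField.complexConj L : L ≃ₐ[↥(maximalRealSubfield L)] L) : L →+* L) H Γ) :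
    ProperlyDiscontinuousSMul (archImageU21 L H τ T hT Γ) Ball :=
  properlyDiscontinuousSMul_of_finite _ fun _ _ hK hK' ↦
    finite_setOf_smul_mem_archImageU21 L H τ T hT hdef hΓc hK hK'

/-- **`Δ` acts freely on `𝔹²`** for torsion-free `Γ` (Mathlib's `IsCancelSMul`, through the constructor
`BallModel.isCancelSMul_of_smul_eq_imp`). [cite: BergeronMillsonMoeglin2016Balls, Introduction §1.1] -/
theorem isCancelSMul_archImageU21
    (hdef : ∀ τ' : L →+* ℂ, InfinitePlace.mk τ' ≠ InfinitePlace.mk τ → (H.map τ').PosDef)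
    (hΓc : IsCongruenceSubgroup
      ((IsCMField.complexConj L : L ≃ₐ[↥(maximalRealSubfield L)] L) : L →+* L) H Γ)
    (htf : ∀ γ ∈ Γ, IsOfFinOrder γ → γ = 1) :
    IsCancelSMul (archImageU21 L H τ T hT Γ) Ball :=
  isCancelSMul_of_smul_eq_imp _ (eq_one_of_smul_eq_of_mem_archImageU21 L H τ T hT hdef hΓc htf)

/-- **An open neighbourhood of `1` in `U(2,1)` meeting `Δ` only in `1`.** [cite: Borel1969, Prop. 7.13] -/
theorem exists_isOpen_inter_archImageU21_eq
    (hdef : ∀ τ' : L →+* ℂ, InfinitePlace.mk τ' ≠ InfinitePlace.mk τ → (H.map τ').PosDef)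
    (hΓc : IsCongruenceSubgroup
      ((IsCMField.complexConj L : L ≃ₐ[↥(maximalRealSubfield L)] L) : L →+* L) H Γ) :
    ∃ U : Set U21, IsOpen U ∧ (1 : U21) ∈ U ∧ ∀ δ ∈ archImageU21 L H τ T hT Γ, δ ∈ U → δ = 1 := by
  obtain ⟨K, hK, hKx⟩ := exists_compact_mem_nhds (x₀ : Ball)
  have hF : {δ : archImageU21 L H τ T hT Γ | ∃ z ∈ K, δ • z ∈ K}.Finite :=
    finite_setOf_smul_mem_archImageU21 L H τ T hT hdef hΓc hK hK
  set S : Set U21 := Subtype.val '' {δ : archImageU21 L H τ T hT Γ | ∃ z ∈ K, δ • z ∈ K} \ {1}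
    with hS_def
  have hS : IsClosed S := ((hF.image _).sdiff).isClosed
  set V : Set U21 := (fun g : U21 ↦ g • x₀) ⁻¹' interior K with hV_def
  have hV : IsOpen V := isOpen_interior.preimage (continuous_id.smul continuous_const)
  refine ⟨V ∩ Sᶜ, hV.inter hS.isOpen_compl, ⟨?_, fun h ↦ h.2 rfl⟩, fun δ hδ hδU ↦ ?_⟩
  · show (1 : U21) • x₀ ∈ interior K
    rw [one_smul]
    exact mem_interior_iff_mem_nhds.2 hKx
  · by_contra hne
    refine hδU.2 ⟨⟨⟨δ, hδ⟩, ⟨x₀, mem_of_mem_nhds hKx, ?_⟩, rfl⟩, hne⟩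
    exact interior_subset hδU.1

/-- **`Δ = {T⁻¹ γ^τ T | γ ∈ Γ}` is a discrete subgroup of `U(2,1)`** (Borel 1969, §1: arithmetic
subgroups are discrete). [cite: Borel1969, Prop. 7.13] -/
theorem discreteTopology_archImageU21
    (hdef : ∀ τ' : L →+* ℂ, InfinitePlace.mk τ' ≠ InfinitePlace.mk τ → (H.map τ').PosDef)
    (hΓc : IsCongruenceSubgroup
      ((IsCMField.complexConj L : L ≃ₐ[↥(maximalRealSubfield L)] L) : L →+* L) H Γ) :
    DiscreteTopology (archImageU21 L H τ T hT Γ) := by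
  obtain ⟨U, hU, h1U, hU1⟩ := exists_isOpen_inter_archImageU21_eq L H τ T hT hdef hΓc
  refine discreteTopology_of_isOpen_singleton_one ?_
  have h : ({1} : Set (archImageU21 L H τ T hT Γ)) = Subtype.val ⁻¹' U := by
    ext δ
    simp only [Set.mem_singleton_iff, Set.mem_preimage]
    constructor
    · rintro rfl
      exact h1U
    · intro hδ
      exact Subtype.ext (hU1 δ.1 δ.2 hδ)
  rw [h]
  exact hU.preimage continuous_subtype_val

/-! ### The compact complex surface `S(Γ) = Γ \ 𝔹²` -/

/-- **`Γ \ 𝔹²` is a complex manifold** (holomorphic atlas modelled on `ℂ²`) for a torsion-free congruence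
subgroup `Γ` of `U(H)(L⁺)`, `H` definite off the place of `τ` — the quotient of the ball by the free
properly discontinuous action of `Δ = {T⁻¹ γ^τ T}` (`BallModel.instIsManifoldQuotient`).
[cite: Shafarevich1994, Ch. IX §3.1] -/
theorem isManifold_ballQuotient_archImageU21
    (hdef : ∀ τ' : L →+* ℂ, InfinitePlace.mk τ' ≠ InfinitePlace.mk τ → (H.map τ').PosDef)
    (hΓc : IsCongruenceSubgroup
      ((IsCMField.complexConj L : L ≃ₐ[↥(maximalRealSubfield L)] L) : L →+* L) H Γ)
    (htf : ∀ γ ∈ Γ, IsOfFinOrder γ → γ = 1) :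
    haveI := properlyDiscontinuousSMul_archImageU21 L H τ T hT hdef hΓc
    haveI := isCancelSMul_archImageU21 L H τ T hT hdef hΓc htf
    IsManifold 𝓘(ℂ, Fin 2 → ℂ) ω
      (MulAction.orbitRel.Quotient (archImageU21 L H τ T hT Γ) Ball) := by
  haveI := properlyDiscontinuousSMul_archImageU21 L H τ T hT hdef hΓc
  haveI := isCancelSMul_archImageU21 L H τ T hT hdef hΓc htf
  infer_instance

/-- **`Γ \ 𝔹²` is Hausdorff** (`t2Space_of_properlyDiscontinuousSMul_of_t2Space`).
[cite: Shafarevich1994, Ch. IX §3.1] -/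
theorem t2Space_ballQuotient_archImageU21
    (hdef : ∀ τ' : L →+* ℂ, InfinitePlace.mk τ' ≠ InfinitePlace.mk τ → (H.map τ').PosDef)
    (hΓc : IsCongruenceSubgroup
      ((IsCMField.complexConj L : L ≃ₐ[↥(maximalRealSubfield L)] L) : L →+* L) H Γ) :
    T2Space (MulAction.orbitRel.Quotient (archImageU21 L H τ T hT Γ) Ball) := by
  haveI := properlyDiscontinuousSMul_archImageU21 L H τ T hT hdef hΓc
  exact t2Space_of_properlyDiscontinuousSMul_of_t2Space

/-- **`Γ \ 𝔹²` is compact** for `H` moreover ANISOTROPIC over `L`: `U(2,1)/Δ` is compact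
(`compactSpace_U21_quotient_archImageU21_of_isCongruenceSubgroup`, Godement's criterion) and maps onto
`Δ \ 𝔹²` (`BallModel.compactSpace_quotient_of_compactSpace_quotientGroup`). With the two theorems above:
the COMPACT COMPLEX SURFACE `S(Γ)` attached to `(L, H, τ, T, Γ)`. [cite: Godement1964, §5 Theorem 4]
[cite: BergeronMillsonMoeglin2016Balls, Introduction §1.1] -/
theorem compactSpace_ballQuotient_archImageU21
    (hanis : ∀ x : Fin 3 → L, hermForm (cmConjRingHom L) H x x = 0 → x = 0)
    (hdef : ∀ τ' : L →+* ℂ, InfinitePlace.mk τ' ≠ InfinitePlace.mk τ → (H.map τ').PosDef)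
    (hΓc : IsCongruenceSubgroup
      ((IsCMField.complexConj L : L ≃ₐ[↥(maximalRealSubfield L)] L) : L →+* L) H Γ)
    (htf : ∀ γ ∈ Γ, IsOfFinOrder γ → γ = 1) :
    CompactSpace (MulAction.orbitRel.Quotient (archImageU21 L H τ T hT Γ) Ball) := by
  haveI := properlyDiscontinuousSMul_archImageU21 L H τ T hT hdef hΓc
  haveI := isCancelSMul_archImageU21 L H τ T hT hdef hΓc htf
  haveI := compactSpace_U21_quotient_archImageU21_of_isCongruenceSubgroup L H τ T hT hanis hΓc
  exact compactSpace_quotient_of_compactSpace_quotientGroup _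

end CM

/-! ### In the currency of `PicardCM.BallQuotientUniformised` (`E ⊂ ℂ`, `conjRingHom E`, `Tᴴ H^{τ₁} T = H_{2,1}`) -/

section Subfield

variable {E : Subfield ℂ} [NumberField E] [IsCMField E] (H : Matrix (Fin 3) (Fin 3) E)
  {T : GL (Fin 3) ℂ}
  (hT : (T : Matrix (Fin 3) (Fin 3) ℂ)ᴴ * H.map E.subtype * (T : Matrix (Fin 3) (Fin 3) ℂ) =
    signatureMatrix 2)
  {Γ : Subgroup (GL (Fin 3) E)}

/-- `IsCongruenceSubgroup (conjRingHom E)` is `IsCongruenceSubgroup (complexConj E : E →+* E)`. [folklore] -/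
private theorem isCongruenceSubgroup_coe_complexConj_of_conjRingHom
    (hΓ : IsCongruenceSubgroup (conjRingHom E) H Γ) :
    IsCongruenceSubgroup
      ((IsCMField.complexConj E : E ≃ₐ[↥(maximalRealSubfield E)] E) : E →+* E) H Γ := by
  rwa [conjRingHom_eq_coe_complexConj] at hΓ

/-- **Literally over the binders of `PicardCM.BallQuotientUniformised`: proper discontinuity.** For
`E ⊂ ℂ` CM, `H ∈ M₃(E)` positive definite at the places other than that of `E ↪ ℂ`, a frame
`Tᴴ H^{τ₁} T = H_{2,1}`, and a congruence subgroup `Γ` of `U(H)(E⁺)` (`conjRingHom E` currency), the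
lattice `{T⁻¹ γ T | γ ∈ Γ} ≤ U(2,1)` of `compactSpace_U21_quotient_archImageU21_of_signature_of_isCongruenceSubgroup`
acts properly discontinuously on `𝔹²`. [cite: Borel1969, Prop. 7.13] -/
theorem properlyDiscontinuousSMul_archImageU21_of_signature
    (hdef : ∀ τ' : E →+* ℂ, InfinitePlace.mk τ' ≠ InfinitePlace.mk E.subtype → (H.map τ').PosDef)
    (hΓ : IsCongruenceSubgroup (conjRingHom E) H Γ) :
    ProperlyDiscontinuousSMul
      (archImageU21 (↥E) H E.subtype T (formCongr_eq_J_of_conjTranspose_mul_mul H E.subtype hT) Γ)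
      Ball :=
  properlyDiscontinuousSMul_archImageU21 (↥E) H E.subtype T _ hdef
    (isCongruenceSubgroup_coe_complexConj_of_conjRingHom H hΓ)

/-- **Literally over the binders of `PicardCM.BallQuotientUniformised`: freeness** for torsion-free `Γ`.
[cite: BergeronMillsonMoeglin2016Balls, Introduction §1.1] -/
theorem isCancelSMul_archImageU21_of_signature
    (hdef : ∀ τ' : E →+* ℂ, InfinitePlace.mk τ' ≠ InfinitePlace.mk E.subtype → (H.map τ').PosDef)
    (hΓ : IsCongruenceSubgroup (conjRingHom E) H Γ) (htf : ∀ γ ∈ Γ, IsOfFinOrder γ → γ = 1) :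
    IsCancelSMul
      (archImageU21 (↥E) H E.subtype T (formCongr_eq_J_of_conjTranspose_mul_mul H E.subtype hT) Γ)
      Ball :=
  isCancelSMul_archImageU21 (↥E) H E.subtype T _ hdef
    (isCongruenceSubgroup_coe_complexConj_of_conjRingHom H hΓ) htf

/-- **Literally over the binders of `PicardCM.BallQuotientUniformised`: discreteness**, corner-entry
form (`{δ | ‖δ₂₂‖ ≤ R}` finite). [cite: Borel1969, §1] -/
theorem finite_setOf_norm_22_le_of_mem_archImageU21_of_signature
    (hdef : ∀ τ' : E →+* ℂ, InfinitePlace.mk τ' ≠ InfinitePlace.mk E.subtype → (H.map τ').PosDef)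
    (hΓ : IsCongruenceSubgroup (conjRingHom E) H Γ) (R : ℝ) :
    {δ : archImageU21 (↥E) H E.subtype T (formCongr_eq_J_of_conjTranspose_mul_mul H E.subtype hT) Γ |
      ‖mat (δ : U21) 2 2‖ ≤ R}.Finite :=
  finite_setOf_norm_22_le_of_mem_archImageU21 (↥E) H E.subtype T _ hdef
    (isCongruenceSubgroup_coe_complexConj_of_conjRingHom H hΓ) R

/-- **Literally over the binders of `PicardCM.BallQuotientUniformised`: `Γ \ 𝔹²` is compact** for
`H` anisotropic, positive definite off the place of `E ↪ ℂ`, and `Γ` a torsion-free congruence subgroup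
(`compactSpace_U21_quotient_archImageU21_of_signature_of_isCongruenceSubgroup` +
`BallModel.compactSpace_quotient_of_compactSpace_quotientGroup`). [cite: Godement1964, §5 Theorem 4]
[cite: BergeronMillsonMoeglin2016Balls, Introduction §1.1] -/
theorem compactSpace_ballQuotient_archImageU21_of_signature
    (hanis : ∀ v : Fin 3 → E, hermForm (conjRingHom E) H v v = 0 → v = 0)
    (hdef : ∀ τ' : E →+* ℂ, InfinitePlace.mk τ' ≠ InfinitePlace.mk E.subtype → (H.map τ').PosDef)
    (hΓ : IsCongruenceSubgroup (conjRingHom E) H Γ) (htf : ∀ γ ∈ Γ, IsOfFinOrder γ → γ = 1) :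
    CompactSpace (MulAction.orbitRel.Quotient
      (archImageU21 (↥E) H E.subtype T (formCongr_eq_J_of_conjTranspose_mul_mul H E.subtype hT) Γ)
      Ball) := by
  have hΓ' := isCongruenceSubgroup_coe_complexConj_of_conjRingHom H hΓ
  haveI := properlyDiscontinuousSMul_archImageU21 (↥E) H E.subtype T
    (formCongr_eq_J_of_conjTranspose_mul_mul H E.subtype hT) hdef hΓ'
  haveI := isCancelSMul_archImageU21 (↥E) H E.subtype T
    (formCongr_eq_J_of_conjTranspose_mul_mul H E.subtype hT) hdef hΓ' htf
  haveI := compactSpace_U21_quotient_archImageU21_of_signature_of_isCongruenceSubgroup H hanis hT hΓ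
  exact compactSpace_quotient_of_compactSpace_quotientGroup _

/-- **Literally over the binders of `PicardCM.BallQuotientUniformised`: `Γ \ 𝔹²` is Hausdorff.**
[cite: Shafarevich1994, Ch. IX §3.1] -/
theorem t2Space_ballQuotient_archImageU21_of_signature
    (hdef : ∀ τ' : E →+* ℂ, InfinitePlace.mk τ' ≠ InfinitePlace.mk E.subtype → (H.map τ').PosDef)
    (hΓ : IsCongruenceSubgroup (conjRingHom E) H Γ) :
    T2Space (MulAction.orbitRel.Quotient
      (archImageU21 (↥E) H E.subtype T (formCongr_eq_J_of_conjTranspose_mul_mul H E.subtype hT) Γ)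
      Ball) :=
  t2Space_ballQuotient_archImageU21 (↥E) H E.subtype T _ hdef
    (isCongruenceSubgroup_coe_complexConj_of_conjRingHom H hΓ)

/-- **The complex surface `S(Γ) = Γ \ 𝔹²` of the record `PicardCM.BallQuotientUniformised`, from its
algebraic data alone**: for `E ⊂ ℂ` CM, `H ∈ M₃(E)` positive definite off the place of `E ↪ ℂ`, a frame
`Tᴴ H^{τ₁} T = H_{2,1}`, and `Γ` a torsion-free congruence subgroup of `U(H)(E⁺)`, the quotient
`Δ \ 𝔹²`, `Δ = {T⁻¹ γ T | γ ∈ Γ}`, is a complex manifold modelled on `ℂ²` (for the charted-space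
structure `MulAction.instChartedSpaceQuotient` of the free properly discontinuous action; with the two
theorems above, a COMPACT Hausdorff one when `H` is anisotropic). [cite: Shafarevich1994, Ch. IX §3.1]
[cite: BergeronMillsonMoeglin2016Balls, Introduction §1.1] -/
theorem isManifold_ballQuotient_archImageU21_of_signature
    (hdef : ∀ τ' : E →+* ℂ, InfinitePlace.mk τ' ≠ InfinitePlace.mk E.subtype → (H.map τ').PosDef)
    (hΓ : IsCongruenceSubgroup (conjRingHom E) H Γ) (htf : ∀ γ ∈ Γ, IsOfFinOrder γ → γ = 1) :
    haveI := properlyDiscontinuousSMul_archImageU21_of_signature H hT hdef hΓ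
    haveI := isCancelSMul_archImageU21_of_signature H hT hdef hΓ htf
    IsManifold 𝓘(ℂ, Fin 2 → ℂ) ω
      (MulAction.orbitRel.Quotient
        (archImageU21 (↥E) H E.subtype T (formCongr_eq_J_of_conjTranspose_mul_mul H E.subtype hT) Γ)
        Ball) :=
  isManifold_ballQuotient_archImageU21 (↥E) H E.subtype T _ hdef
    (isCongruenceSubgroup_coe_complexConj_of_conjRingHom H hΓ) htf

end Subfield

end UnitaryGroup

end Literature.NumberTheory.Automorphic

end
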